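import Summits.CriticalPhenomena.CardyFormulaZ2.Theorems.CardyFlipRussoVoronoiHubFromSmirnovHoloUniformBounds

/-!
# Stub `univalent_inverse` of line `moebius-exact-delaunay-dilation-ward`
# (crux `VoronoiHubFromSmirnov`, stmt-CriticalPhenomena-6433)

THE INVERSE OF A UNIVALENT MAP IS UNIVALENT ON THE (OPEN) IMAGE.  The line transports Poisson
nuclei by a univalent (holomorphic and injective) map `h` on an open set `U ⊇ closure Ω`
(I. Benjamini, O. Schramm, *Conformal invariance of Voronoi percolation*, Comm. Math. Phys. 197
(1998) 75–107, §4); the image-side probabilistic step needs the inverse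
`g = Function.invFunOn h U` as a univalent map of the open image `h '' U`.  This file packages:
`h '' U` is open, `g` is complex-differentiable and injective on `h '' U`, `g ∘ h = id` on `U`,
`h ∘ g = id` on `h '' U`, and `deriv h ≠ 0` on `U`.

Proof.  All ingredients are in the tree / Mathlib:
* `deriv h z ≠ 0` for `z ∈ U` is the one-variable case of the Clements–Osgood theorem
  (`Literature.Analysis.Complex.SCV.deriv_ne_zero_of_injOn`, Fritzsche–Grauert Thm. I.8.5);
* with a zero-free derivative, the image of the open `U` is open
  (`Complex.isOpen_image_of_deriv_ne_zero`, inverse function theorem) and the inverse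
  `Function.invFunOn h U` is holomorphic on it (`Complex.differentiableOn_invFunOn_image`,
  Conway IV.7.6: continuity of the inverse from `HasStrictDerivAt.map_nhds_eq`, then
  `HasStrictDerivAt.of_local_left_inverse`);
* the set-theoretic identities are `Set.InjOn.leftInvOn_invFunOn`, `Function.invFunOn_eq` and
  `Function.invFunOn_injOn_image`.

No new definitions, no new cited facts.
-/

namespace Summit.CriticalPhenomena.CardyFormulaZ2.Cruxes.VoronoiHubFromSmirnov.MoebiusExactDelaunayDilationWard

open Set Function

/-- **The inverse of a univalent map is univalent on the open image.**  Let `h : ℂ → ℂ` be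
complex-differentiable and injective on the open set `U`.  Then the image `h '' U` is open, the
inverse `Function.invFunOn h U` is complex-differentiable and injective on `h '' U`, it is a
two-sided inverse of `h` (`invFunOn h U (h z) = z` for `z ∈ U` and `h (invFunOn h U w) = w` for
`w ∈ h '' U`), and `deriv h z ≠ 0` for every `z ∈ U`.  Proof: `deriv h ≠ 0` on `U` by
`Literature.Analysis.Complex.SCV.deriv_ne_zero_of_injOn` (Fritzsche–Grauert Thm. I.8.5, `n = 1`);
then `Complex.isOpen_image_of_deriv_ne_zero` and `Complex.differentiableOn_invFunOn_image`
(inverse function theorem, Conway IV.7.6) give openness of the image and holomorphy of the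
inverse, and the identities are `Set.InjOn.leftInvOn_invFunOn`, `Function.invFunOn_eq`,
`Function.invFunOn_injOn_image`. -/
theorem univalent_inverse : ∀ (h : ℂ → ℂ) (U : Set ℂ), IsOpen U → DifferentiableOn ℂ h U → Set.InjOn h U → IsOpen (h '' U) ∧ DifferentiableOn ℂ (Function.invFunOn h U) (h '' U) ∧ Set.InjOn (Function.invFunOn h U) (h '' U) ∧ (∀ z ∈ U, Function.invFunOn h U (h z) = z) ∧ (∀ w ∈ h '' U, h (Function.invFunOn h U w) = w) ∧ (∀ z ∈ U, deriv h z ≠ 0) := by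
  intro h U hU hd hi
  -- the derivative of an injective holomorphic function vanishes nowhere (Clements–Osgood, `n = 1`)
  have hne : ∀ z ∈ U, deriv h z ≠ 0 := fun z hz =>
    Literature.Analysis.Complex.SCV.deriv_ne_zero_of_injOn hd hU hi hz
  exact ⟨Complex.isOpen_image_of_deriv_ne_zero hU hd hne,
    Complex.differentiableOn_invFunOn_image hU hd hi hne,
    invFunOn_injOn_image h U,
    fun z hz => hi.leftInvOn_invFunOn hz,
    fun w hw => invFunOn_eq hw,
    hne⟩

end Summit.CriticalPhenomena.CardyFormulaZ2.Cruxes.VoronoiHubFromSmirnov.MoebiusExactDelaunayDilationWard
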